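import Mathlib
import Summits.KontsevichZagierPeriods.KontsevichZagierPeriods.Theorems.SoloInformedSumPieces
import Summits.KontsevichZagierPeriods.KontsevichZagierPeriods.Theorems.SoloInformedNashSimplex
import HarnessLib
import HarnessLib.Audit

/-!
# SoloInformed — the star side of the depth-2 telescope step, every weight (PROGRAMME XXXIX, file 4)

Solo programme `solo-KontsevichZagierPeriods-informed`, session s46. Dimension `n = m + 4`;
write `A = x₀x₁⋯x_{m+2}` and `B = x_{m+3}`. The right-hand side of the telescope step is
`R₂ = [(0,1)ⁿ, 1/((1 − A)(1 − AB))]`; partial fractions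

  `1/((1 − A)(1 − AB)) = A/((1 − A)(1 − AB)) + 1/(1 − AB)`

split it (rule (1b)) into `P₁ + P₂`, and the cube-to-simplex chart `κ(x)_j = x₀⋯x_j` (rule (2))
identifies `P₁ ≡ Z(m+3, 1)` and `P₂ ≡ Z(m+4)`. Hence, in the formal period ring,
`⟦R₂⟧ = mzvClass [m+3, 1] + mzvClass [m+4]` (`soloInformed_sum_R2_class`).

References: Kontsevich–Zagier 2001 §1.2 [KontsevichZagier2001]; Zagier 1994 (the cube form of
`ζ(n)`); Hoffman 1992.
-/

noncomputable section

open MeasureTheory Set MvPolynomial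
open Literature.ModelTheory.ExponentialFields Literature.NumberTheory.Transcendental
open Literature.NumberTheory.Transcendental.KZ

namespace Summit.KontsevichZagierPeriods.KontsevichZagierPeriods.Theorems

variable {m : ℕ}

/-! ## 1. Simplex representations of a given word, in any dimension -/

/-- For an admissible `u` of weight `N` there is a representation IN DIMENSION `N` on Kontsevich's
simplex with the word-product integrand and class `mzvClass u` (namely `mzvRep u`, transported
along `weight u = N` by `subst`). -/
theorem soloInformed_exists_wordRep {u : List ℕ} (hu : MZV.IsAdmissible u) {N : ℕ}
    (h : MZV.weight u = N) : ∃ r : IntegralRep N, r.domain = openOrderedSimplex N ∧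
      (∀ w, r.integrand w = ∏ k : Fin N, mzvForm ((MZV.binaryWord u).getD k false) (w k)) ∧
      toFormalPeriod (of r) = mzvClass u := by
  subst h
  exact ⟨mzvRep u hu (mzvIntegrand_isSemialgebraicFunOn_holds u) (mzvIntegrand_integrableOn_holds u hu),
    rfl, fun w => rfl, (mzvClass_of_isAdmissible hu).symm⟩

/-- `soloInformedOrdSimplex n = KZ.openOrderedSimplex n`. -/
theorem soloInformed_ordSimplex_eq (n : ℕ) : soloInformedOrdSimplex n = openOrderedSimplex n := by
  ext t
  exact ⟨fun h => ⟨fun j => (h.1 j).1, fun j => (h.1 j).2, fun a b hab => h.2 hab⟩,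
    fun h => ⟨fun j => ⟨h.1 j, h.2.1 j⟩, fun a b hab => h.2.2 hab⟩⟩

/-- `κ((0,1)ⁿ) = KZ.openOrderedSimplex n`. -/
theorem soloInformed_image_kappa_eq (n : ℕ) :
    soloInformedKappaMap n '' soloInformedOpenCube n = openOrderedSimplex n := by
  rw [soloInformed_image_kappa, soloInformed_ordSimplex_eq]

/-! ## 2. The words of `Z(m+3,1)` and `Z(m+4)` -/

/-- The word of `Z(m+3, 1)` is the garland letter vector `ε`. -/
theorem soloInformed_word_m31 (k : Fin (m + 4)) :
    (MZV.binaryWord [m + 3, 1]).getD k false = soloInformedSumEps m k := by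
  have h := soloInformed_sumIdx_getD (m := m) (s := Fin.last (m + 3)) (Fin.last_pos'.ne') k
  rw [soloInformedSumIdx, if_pos rfl] at h
  rw [h, Bool.eq_iff_iff]
  simp only [soloInformedSumQslot, if_pos, decide_eq_true_eq, soloInformedSumEps]
  exact or_comm

/-- The word of `Z(m+4)`: a single `1`, at the last position. -/
theorem soloInformed_word_m4 (k : Fin (m + 4)) :
    (MZV.binaryWord [m + 4]).getD k false = decide (k = Fin.last (m + 3)) := by
  have hw : MZV.binaryWord [m + 4] = List.replicate (m + 3) false ++ [true] := by
    simp [MZV.binaryWord]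
  have hk := k.2
  rw [hw, soloInformed_getD_replicate_false_append]
  split_ifs with h1
  · symm; simp only [decide_eq_false_iff_not, Fin.ext_iff, Fin.val_last]; omega
  · rw [show (k : ℕ) - (m + 3) = 0 by omega, List.getD_cons_zero]
    symm; simp only [decide_eq_true_eq, Fin.ext_iff, Fin.val_last]; omega

/-- The word-product of `Z(m+4)` in closed form. -/
theorem soloInformed_wordProd_m4 (t : Fin (m + 4) → ℝ) :
    ∏ k : Fin (m + 4), mzvForm (decide (k = Fin.last (m + 3))) (t k) =
      1 / ((∏ i : Fin (m + 3), t (Fin.castSucc i)) * (1 - t (Fin.last (m + 3)))) := by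
  rw [Fin.prod_univ_castSucc]
  have h : ∀ i : Fin (m + 3), decide (Fin.castSucc i = Fin.last (m + 3)) = false := fun i =>
    decide_eq_false (Fin.castSucc_lt_last i).ne
  simp only [h, decide_true, mzvForm, if_true, Bool.false_eq_true, if_false, one_div]
  rw [Finset.prod_inv_distrib, ← mul_inv]

/-! ## 3. `κ` in dimension `m + 4` -/

/-- The product of the variables below the last index is `A`. -/
theorem soloInformed_prod_lt_last (x : Fin (m + 4) → ℝ) :
    ∏ l ∈ Finset.univ.filter (fun l : Fin (m + 4) => l < Fin.last (m + 3)), x l =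
      soloInformedPrefixProd x (Fin.castSucc (Fin.last (m + 2))) := by
  rw [soloInformedPrefixProd]
  congr 1
  ext l
  simp only [Finset.mem_filter, Finset.mem_univ, true_and, Fin.lt_def, Fin.le_def, Fin.val_last,
    Fin.val_castSucc]
  omega

/-- `det J_κ(x) = D(x) · A(x)` with `D = ∏_{j ≤ m+1} κ(x)_j`, `A = κ(x)_{m+2} = x₁⋯x_{m+2}·x₀`. -/
theorem soloInformed_det_kappa_sum (x : Fin (m + 4) → ℝ) :
    (soloInformedJacCLM (soloInformedMonoPoly (m + 4)) x).det =
      (∏ j : Fin (m + 2), soloInformedPrefixProd x (Fin.castSucc (Fin.castSucc j))) *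
        (soloInformedMidProd x * x 0) := by
  rw [soloInformed_det_jacCLM_kappa, Fin.prod_univ_castSucc, soloInformed_prod_prod_lt_castSucc,
    soloInformed_prod_lt_last, soloInformed_prefixProd_csLast]

/-- `∏_{i ≤ m+2} κ(x)_i = D(x) · A(x)`. -/
theorem soloInformed_prod_kappa_castSucc (x : Fin (m + 4) → ℝ) :
    ∏ i : Fin (m + 3), soloInformedPrefixProd x (Fin.castSucc i) =
      (∏ j : Fin (m + 2), soloInformedPrefixProd x (Fin.castSucc (Fin.castSucc j))) *
        (soloInformedMidProd x * x 0) := by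
  rw [Fin.prod_univ_castSucc, soloInformed_prefixProd_csLast]

/-- `D(x) > 0` on the cube. -/
theorem soloInformed_sumD_pos {x : Fin (m + 4) → ℝ} (hx : x ∈ soloInformedOpenCube (m + 4)) :
    0 < ∏ j : Fin (m + 2), soloInformedPrefixProd x (Fin.castSucc (Fin.castSucc j)) :=
  Finset.prod_pos fun _ _ => soloInformed_prefixProd_pos hx _

/-! ## 4. The two pieces of the star side -/

/-- `p₁ = A/((1 − A)(1 − AB))`. -/
def soloInformedSumP1f (x : Fin (m + 4) → ℝ) : ℝ :=
  soloInformedMidProd x * x 0 /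
    ((1 - soloInformedMidProd x * x 0) * (1 - soloInformedMidProd x * x 0 * x (Fin.last (m + 3))))

/-- `p₂ = 1/(1 − AB)`. -/
def soloInformedSumP2f (x : Fin (m + 4) → ℝ) : ℝ :=
  1 / (1 - soloInformedMidProd x * x 0 * x (Fin.last (m + 3)))

section bounds
variable {x : Fin (m + 4) → ℝ} (hx : x ∈ soloInformedOpenCube (m + 4))
include hx

/-- **Partial fractions**: `R₂ = p₁ + p₂` on the cube. -/
theorem soloInformed_sumR2_eq_add : (soloInformedSumDatum m).R2.integrand x =
    soloInformedSumP1f x + soloInformedSumP2f x := by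
  rw [soloInformedSum_R2_integrand, soloInformedSumP1f, soloInformedSumP2f]
  have ha := (soloInformed_sum_one_sub_pos hx).ne'
  have hb := (soloInformed_sum_one_sub_pos' hx).ne'
  field_simp
  ring

/-- `0 ≤ p₁`. -/
theorem soloInformed_sumP1f_nonneg : 0 ≤ soloInformedSumP1f x :=
  div_nonneg (mul_nonneg (soloInformed_midProd_pos hx).le (hx 0).1.le)
    (mul_nonneg (soloInformed_sum_one_sub_pos hx).le (soloInformed_sum_one_sub_pos' hx).le)

/-- `0 ≤ p₂`. -/
theorem soloInformed_sumP2f_nonneg : 0 ≤ soloInformedSumP2f x :=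
  div_nonneg zero_le_one (soloInformed_sum_one_sub_pos' hx).le

/-- `|p₁| ≤ W_{1/2}`. -/
theorem soloInformed_sumP1f_le_W : |soloInformedSumP1f x| ≤ 1 * soloInformedW (fun _ => 1 / 2) x := by
  rw [abs_of_nonneg (soloInformed_sumP1f_nonneg hx), one_mul]
  have h := soloInformed_sumR2_eq_add hx
  rw [soloInformedSum_R2_integrand] at h
  linarith [soloInformed_sumFS_le_W hx, soloInformed_sumP2f_nonneg hx]

/-- `|p₂| ≤ W_{1/2}`. -/
theorem soloInformed_sumP2f_le_W : |soloInformedSumP2f x| ≤ 1 * soloInformedW (fun _ => 1 / 2) x := by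
  rw [abs_of_nonneg (soloInformed_sumP2f_nonneg hx), one_mul]
  have h := soloInformed_sumR2_eq_add hx
  rw [soloInformedSum_R2_integrand] at h
  linarith [soloInformed_sumFS_le_W hx, soloInformed_sumP1f_nonneg hx]

/-- **Pull-back of `Z(m+3,1)` along `κ` is `p₁`.** -/
theorem soloInformed_sumP1f_kappa : soloInformedSumP1f x =
    soloInformedSumG (soloInformedKappaMap (m + 4) x) *
      |(soloInformedJacCLM (soloInformedMonoPoly (m + 4)) x).det| := by
  have hD := soloInformed_sumD_pos hx
  have hA : 0 < soloInformedMidProd x * x 0 := mul_pos (soloInformed_midProd_pos hx) (hx 0).1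
  rw [soloInformed_det_kappa_sum, abs_of_pos (mul_pos hD hA), soloInformedSumG_eq]
  simp only [soloInformedKappa_apply, soloInformed_prefixProd_last, soloInformed_prefixProd_csLast]
  rw [soloInformedSumP1f]
  have ha := (soloInformed_sum_one_sub_pos hx).ne'
  have hb := (soloInformed_sum_one_sub_pos' hx).ne'
  have hb' : 1 - x (Fin.last (m + 3)) * (soloInformedMidProd x * x 0) ≠ 0 := by
    rw [mul_comm]; simpa [mul_assoc] using hb
  have hDne := hD.ne'
  have h0 : x 0 ≠ 0 := (hx 0).1.ne'
  have hM : soloInformedMidProd x ≠ 0 := (soloInformed_midProd_pos hx).ne'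
  field_simp

/-- **Pull-back of `Z(m+4)` along `κ` is `p₂`.** -/
theorem soloInformed_sumP2f_kappa : soloInformedSumP2f x =
    (∏ k : Fin (m + 4), mzvForm (decide (k = Fin.last (m + 3))) (soloInformedKappaMap (m + 4) x k)) *
      |(soloInformedJacCLM (soloInformedMonoPoly (m + 4)) x).det| := by
  have hD := soloInformed_sumD_pos hx
  have hA : 0 < soloInformedMidProd x * x 0 := mul_pos (soloInformed_midProd_pos hx) (hx 0).1
  rw [soloInformed_det_kappa_sum, abs_of_pos (mul_pos hD hA), soloInformed_wordProd_m4]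
  simp only [soloInformedKappa_apply, soloInformed_prefixProd_last, soloInformed_prod_kappa_castSucc,
    soloInformed_prefixProd_csLast]
  rw [soloInformedSumP2f]
  have hb := (soloInformed_sum_one_sub_pos' hx).ne'
  have hb' : 1 - x (Fin.last (m + 3)) * (soloInformedMidProd x * x 0) ≠ 0 := by
    rw [mul_comm]; simpa [mul_assoc] using hb
  have hDne := hD.ne'
  have h0 : x 0 ≠ 0 := (hx 0).1.ne'
  have hM : soloInformedMidProd x ≠ 0 := (soloInformed_midProd_pos hx).ne'
  field_simp

end bounds

/-- Continuity of `A = x₁⋯x_{m+2}·x₀`. -/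
theorem soloInformed_continuous_sumA :
    Continuous fun x : Fin (m + 4) → ℝ => soloInformedMidProd x * x 0 := by
  unfold soloInformedMidProd; fun_prop

/-- Continuity of `p₁` on the cube. -/
theorem soloInformed_continuousOn_sumP1f :
    ContinuousOn (soloInformedSumP1f (m := m)) (soloInformedOpenCube (m + 4)) := by
  have hA := soloInformed_continuous_sumA (m := m)
  refine ContinuousOn.div hA.continuousOn (Continuous.continuousOn ?_) fun x hx =>
    (mul_pos (soloInformed_sum_one_sub_pos hx) (soloInformed_sum_one_sub_pos' hx)).ne'
  exact (continuous_const.sub hA).mul (continuous_const.sub (hA.mul (continuous_apply _)))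

/-- Continuity of `p₂` on the cube. -/
theorem soloInformed_continuousOn_sumP2f :
    ContinuousOn (soloInformedSumP2f (m := m)) (soloInformedOpenCube (m + 4)) := by
  have hA := soloInformed_continuous_sumA (m := m)
  exact ContinuousOn.div continuousOn_const
    (continuous_const.sub (hA.mul (continuous_apply _))).continuousOn
    fun x hx => (soloInformed_sum_one_sub_pos' hx).ne'

/-- `P₁ = [(0,1)ⁿ, p₁]`. -/
def soloInformedSumP1 (m : ℕ) : IntegralRep (m + 4) where
  domain := soloInformedOpenCube (m + 4)
  integrand := soloInformedSumP1f
  isSemialgebraic_domain := isSemialgebraic_soloInformedOpenCube _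
  isSemialgebraicFunOn_integrand :=
    soloInformed_isSemialgebraicFunOn_quot (isSemialgebraic_soloInformedOpenCube _)
      (soloInformedSumQ m * X 0)
      ((1 - soloInformedSumQ m * X 0) * (1 - soloInformedSumQ m * X 0 * X (Fin.last (m + 3)))) _
      (fun x hx => by
        simpa using (mul_pos (soloInformed_sum_one_sub_pos hx) (soloInformed_sum_one_sub_pos' hx)).ne')
      fun x _ => by simp [soloInformedSumP1f]
  integrableOn := soloInformed_integrableOn_of_le_W (soloInformed_measurableSet_openCube _) subset_rfl
    soloInformed_continuousOn_sumP1f (fun _ => 1 / 2) (fun _ => by norm_num) 1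
    fun _ hx => soloInformed_sumP1f_le_W hx

/-- `P₂ = [(0,1)ⁿ, p₂]`. -/
def soloInformedSumP2 (m : ℕ) : IntegralRep (m + 4) where
  domain := soloInformedOpenCube (m + 4)
  integrand := soloInformedSumP2f
  isSemialgebraic_domain := isSemialgebraic_soloInformedOpenCube _
  isSemialgebraicFunOn_integrand :=
    soloInformed_isSemialgebraicFunOn_quot (isSemialgebraic_soloInformedOpenCube _) 1
      (1 - soloInformedSumQ m * X 0 * X (Fin.last (m + 3))) _
      (fun x hx => by simpa using (soloInformed_sum_one_sub_pos' hx).ne')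
      fun x _ => by simp [soloInformedSumP2f]
  integrableOn := soloInformed_integrableOn_of_le_W (soloInformed_measurableSet_openCube _) subset_rfl
    soloInformed_continuousOn_sumP2f (fun _ => 1 / 2) (fun _ => by norm_num) 1
    fun _ hx => soloInformed_sumP2f_le_W hx

/-! ## 5. The moves and the class of the star side -/

/-- **(1b)** `[R₂] − [P₁] − [P₂] ∈ relations`. -/
theorem soloInformed_sum_smove1 : of (soloInformedSumDatum m).R2 - of (soloInformedSumP1 m) -
    of (soloInformedSumP2 m) ∈ relations :=
  integrandAddRel_subset_relations ⟨m + 4, (soloInformedSumDatum m).R2, soloInformedSumP1 m,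
    soloInformedSumP2 m, rfl, rfl, fun _ hx => soloInformed_sumR2_eq_add hx, rfl⟩

/-- **`⟦P₁⟧ = mzvClass [m+3, 1]`** (rule (2) along `κ`). -/
theorem soloInformed_sumP1_class : toFormalPeriod (of (soloInformedSumP1 m)) = mzvClass [m + 3, 1] := by
  obtain ⟨r, hd, hi, hcl⟩ := soloInformed_exists_wordRep (u := [m + 3, 1]) (N := m + 4)
    ⟨by simp, fun _ => by simp⟩ (by simp [MZV.weight])
  rw [← hcl, toFormalPeriod_eq_iff]
  refine soloInformed_of_sub_of_mem_relations_polyMapCLM (soloInformedMonoPoly (m + 4)) _ r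
    (soloInformed_injOn_kappa (m + 4)) (by rw [hd]; exact (soloInformed_image_kappa_eq (m + 4)).symm)
    fun x hx => ?_
  rw [hi]
  simp only [soloInformed_word_m31]
  exact soloInformed_sumP1f_kappa hx

/-- **`⟦P₂⟧ = mzvClass [m+4]`** (rule (2) along `κ`). -/
theorem soloInformed_sumP2_class : toFormalPeriod (of (soloInformedSumP2 m)) = mzvClass [m + 4] := by
  obtain ⟨r, hd, hi, hcl⟩ := soloInformed_exists_wordRep (u := [m + 4]) (N := m + 4)
    ⟨by simp, fun _ => by simp⟩ (by simp [MZV.weight])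
  rw [← hcl, toFormalPeriod_eq_iff]
  refine soloInformed_of_sub_of_mem_relations_polyMapCLM (soloInformedMonoPoly (m + 4)) _ r
    (soloInformed_injOn_kappa (m + 4)) (by rw [hd]; exact (soloInformed_image_kappa_eq (m + 4)).symm)
    fun x hx => ?_
  rw [hi]
  simp only [soloInformed_word_m4]
  exact soloInformed_sumP2f_kappa hx

/-- **`⟦R₂⟧ = mzvClass [m+3, 1] + mzvClass [m+4]`.** -/
theorem soloInformed_sum_R2_class : toFormalPeriod (of (soloInformedSumDatum m).R2) =
    mzvClass [m + 3, 1] + mzvClass [m + 4] := by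
  rw [← soloInformed_sumP1_class, ← soloInformed_sumP2_class, ← map_add, toFormalPeriod_eq_iff]
  simpa [sub_sub] using soloInformed_sum_smove1 (m := m)

end Summit.KontsevichZagierPeriods.KontsevichZagierPeriods.Theorems
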